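import Summits.AtomisticToContinuum.FouriersLaw.Theorems.OddSectorIrreversibilityTapLeakBoundBlockConeEnergy

/-!
# `TapLeakBound` (stmt-AtomisticToContinuum-15159), line `SketchIdeator2`, floor of `stub_kickCone`: the good event

Helper file (`--supports stmt-AtomisticToContinuum-15159`) for crux
P = `Summit.AtomisticToContinuum.FouriersLaw.Theses.OddSectorIrreversibility.TapLeakBound`, registered stub `stub_kickCone`
(C′ `ResampledKickCone`), floor sub-stub `stub_floorGoodKick` (F4). A pure SPECIALISATION of the landed deterministic
block light cone (`kick_current_le_of_box`, `…TapLeakBoundBlockConeCurrent.lean`) combined with the site-energy ⇒ box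
links (`abs_fst_le_of_siteEnergy_le`, `abs_snd_le_of_siteEnergy_le`, `…TapLeakBoundBlockConeEnergy.lean`):

* `half_pow_mul_exp_le` — the numerical constant (from `e^{1/4} ≤ 4/3`)
  `(1/2)^i · e^{i/4} ≤ (2/3)^i`;
* `kick_current_le_of_siteEnergy_le` (registered sub-goal `stub_floorGoodKick`) — **the good event**: if along BOTH
  closed flows `Φ_τ x`, `Φ_τ y` (`y` = `x` kicked at the contact momentum, `p_0 ↦ p'`), during `[0, s]`, every site
  energy on the block `n ≤ 2i+2` is capped by `lam R⁴/4` (`R ≥ 1`), then inside the window `32·A₀·R·s ≤ i`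
  (`A₀ = √(1 + ω₂ + 3 lam + 12 β)`) the kicked transported bond current obeys
  `|j_i(Φ_s x) − j_i(Φ_s y)| ≤ (3/2)(1 + 4β + (1+lam)A₀) R³ (|p_0 − p'| + 2A₀²R³ s)(2/3)^i`
  (block `L = 2i+1`, weight `θ = 1/2`, `Λ = A₀ R`, momentum cap `P = (1+lam)R²`; the Grönwall factor
  `e^{8Λs} ≤ e^{i/4}` of the cone is absorbed by `(1/2)^i e^{i/4} ≤ (2/3)^i`).

References: folklore (finite-block Lieb–Robinson-type bounds for classical anharmonic lattices, MPPT 1978 /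
BCDM 2007 / Raz–Sims 2009, combined with local energy caps). Nothing here closes the item.
-/

noncomputable section

open MeasureTheory ProbabilityTheory Filter Topology Set Function
open scoped NNReal ENNReal

namespace Summit.AtomisticToContinuum.FouriersLaw.Theorems.OddSectorIrreversibility.TapLeak

open Literature.MathematicalPhysics.KineticTheory.HeatConduction
open Literature.MathematicalPhysics.KineticTheory
open Summit.AtomisticToContinuum.FouriersLaw.Theorems.ClosedConeSensitivity.Negative.ZeroFrictionDictionary

/-! ### §13 A numerical constant -/

/-- `(1/2)^i · e^{i/4} ≤ (2/3)^i`, since `e^{1/4} ≤ 1/(1 - 1/4) = 4/3` (`e^x ≤ 1/(1-x)` on `[0, 1)`,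
Mathlib's `Real.exp_bound_div_one_sub_of_interval`). [folklore] -/
theorem half_pow_mul_exp_le (i : ℕ) : (1 / 2 : ℝ) ^ i * Real.exp ((i : ℝ) / 4) ≤ (2 / 3) ^ i := by
  have h : Real.exp ((i : ℝ) / 4) = Real.exp (1 / 4) ^ i := by
    rw [← Real.exp_nat_mul]; congr 1; ring
  rw [h, ← mul_pow]
  refine pow_le_pow_left₀ (by positivity) ?_ i
  have h4 : Real.exp (1 / 4) ≤ 1 / (1 - 1 / 4) := Real.exp_bound_div_one_sub_of_interval (by norm_num) (by norm_num)
  norm_num at h4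
  linarith

/-! ### §14 The good event: capped site energies ⇒ geometric decay of the kicked transported current -/

section GoodKick

variable {ω₂ lam β : ℝ} (hω : 0 < ω₂) (hl : 0 < lam) (hβ : 0 ≤ β) {N : ℕ} (X : Fin N → PhaseSpace N → ℝ)
  (hX : ∀ m : Fin N, X m = (fun x => (∑ k' : Fin N, (if k' = m then (1 : ℝ) else 0) *
      (x.2 k' ^ 2 / 2 + (pinnedChain ω₂ lam β 0).U (x.1 k'))) +
    ∑ k' : Fin N, ∑ l : Fin N, if l.val = k'.val + 1 then
      ((if k' = m then (1 : ℝ) else 0) + (if l = m then (1 : ℝ) else 0)) / 2 * (pinnedChain ω₂ lam β 0).V (x.1 l - x.1 k')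
      else 0))
include hω hl hβ hX

/-- **THE GOOD EVENT.** For the closed pinned chain (`0 < ω₂`, `0 < lam`, `0 ≤ β`), the family `X m` of site energies,
a bond `i` (`i + 1 < N`), a phase point `x`, the kicked point `y = (x.1, x.2[0 ↦ p'])`, a scale `R ≥ 1` and a time
`s ≥ 0` inside the window `32 √(1 + ω₂ + 3 lam + 12 β) R s ≤ i`: if every site energy `X_n`, `n ≤ 2i+2`, is at most
`lam R⁴/4` along both flows during `[0, s]`, then
`|j_i(Φ_s x) − j_i(Φ_s y)| ≤ (3/2)(1 + 4β + (1+lam)√(1+ω₂+3lam+12β)) R³ (|x.2 0 − p'| + 2(1+ω₂+3lam+12β)R³ s)(2/3)^i`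
— the block light cone `kick_current_le_of_box` with `L = 2i+1`, `θ = 1/2`, `Λ = √(1+ω₂+3lam+12β)·R`,
`P = (1+lam)R²`, the box and the momentum cap being read off the energy caps. [folklore] -/
theorem kick_current_le_of_siteEnergy_le {i : ℕ} (hiN : i + 1 < N) (x : PhaseSpace N) (p' : ℝ) {R s : ℝ}
    (hR : 1 ≤ R) (hs : 0 ≤ s) (hwin : 32 * Real.sqrt (1 + ω₂ + 3 * lam + 12 * β) * R * s ≤ i)
    (hcap : ∀ τ ∈ Icc (0 : ℝ) s, ∀ (n : ℕ) (h : n < N), n ≤ 2 * i + 2 →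
      X ⟨n, h⟩ (detFlow ω₂ lam β N τ x) ≤ lam * R ^ 4 / 4 ∧
        X ⟨n, h⟩ (detFlow ω₂ lam β N τ (x.1, Function.update x.2 ⟨0, by omega⟩ p')) ≤ lam * R ^ 4 / 4) :
    |(pinnedChain ω₂ lam β 0).bondCurrent N ⟨i, by omega⟩ (detFlow ω₂ lam β N s x) -
        (pinnedChain ω₂ lam β 0).bondCurrent N ⟨i, by omega⟩
          (detFlow ω₂ lam β N s (x.1, Function.update x.2 ⟨0, by omega⟩ p'))| ≤
      3 / 2 * (1 + 4 * β + (1 + lam) * Real.sqrt (1 + ω₂ + 3 * lam + 12 * β)) * R ^ 3 *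
        (|x.2 ⟨0, by omega⟩ - p'| + 2 * (1 + ω₂ + 3 * lam + 12 * β) * R ^ 3 * s) * (2 / 3) ^ i := by
  have hN : 0 < N := by omega
  have hiN' : i < N := by omega
  -- the constants `K = A₀²`, `A₀`
  set K := 1 + ω₂ + 3 * lam + 12 * β with hK
  set A₀ := Real.sqrt K with hA₀
  have hK1 : 1 ≤ K := by rw [hK]; linarith
  have hK0 : 0 ≤ K := zero_le_one.trans hK1
  have hA1 : 1 ≤ A₀ := Real.one_le_sqrt.2 hK1
  have hA0 : 0 ≤ A₀ := zero_le_one.trans hA1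
  have hAsq : A₀ ^ 2 = K := Real.sq_sqrt hK0
  have hR0 : 0 ≤ R := zero_le_one.trans hR
  have hR2 : 1 ≤ R ^ 2 := by nlinarith
  have hΛ1 : 1 ≤ A₀ * R := by
    have h := mul_le_mul hA1 hR zero_le_one hA0
    linarith
  have hΛsq : (A₀ * R) ^ 2 = K * R ^ 2 := by rw [mul_pow, hAsq]
  have hΛU : |ω₂| + 3 * lam * R ^ 2 ≤ (A₀ * R) ^ 2 := by
    rw [hΛsq, abs_of_pos hω, hK]
    nlinarith [mul_nonneg hω.le (sub_nonneg.2 hR2), mul_nonneg hβ (zero_le_one.trans hR2)]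
  have hΛV : 1 + 12 * β * R ^ 2 ≤ (A₀ * R) ^ 2 := by
    rw [hΛsq, hK]
    nlinarith [mul_nonneg hω.le (zero_le_one.trans hR2), mul_nonneg hl.le (zero_le_one.trans hR2)]
  have hP0 : 0 ≤ (1 + lam) * R ^ 2 := by positivity
  -- the energy cap `lam R⁴/4` gives the position box `R` and the momentum cap `(1+lam)R²`
  have hER : 4 * (lam * R ^ 4 / 4) / lam ≤ R ^ 4 := by
    rw [div_le_iff₀ hl]; linarith
  have hEP : 2 * (lam * R ^ 4 / 4) ≤ ((1 + lam) * R ^ 2) ^ 2 := by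
    have h4 : 0 ≤ R ^ 4 := by positivity
    nlinarith [mul_nonneg hl.le h4, mul_nonneg (sq_nonneg lam) h4]
  have hbox : ∀ τ ∈ Icc (0 : ℝ) s, ∀ (n : ℕ) (h : n < N), n ≤ 2 * i + 1 + 1 →
      |(detFlow ω₂ lam β N τ x).1 ⟨n, h⟩| ≤ R ∧
        |(detFlow ω₂ lam β N τ (x.1, Function.update x.2 ⟨0, hN⟩ p')).1 ⟨n, h⟩| ≤ R := by
    intro τ hτ n h hn
    have hc := hcap τ hτ n h (by omega)
    exact ⟨abs_fst_le_of_siteEnergy_le hω.le hβ ⟨n, h⟩ (X ⟨n, h⟩) (hX ⟨n, h⟩) hl hR0 hER hc.1,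
      abs_fst_le_of_siteEnergy_le hω.le hβ ⟨n, h⟩ (X ⟨n, h⟩) (hX ⟨n, h⟩) hl hR0 hER hc.2⟩
  have hsI : s ∈ Icc (0 : ℝ) s := ⟨hs, le_rfl⟩
  have hmom : |(detFlow ω₂ lam β N s (x.1, Function.update x.2 ⟨0, hN⟩ p')).2 ⟨i, hiN'⟩| ≤ (1 + lam) * R ^ 2 ∧
      |(detFlow ω₂ lam β N s (x.1, Function.update x.2 ⟨0, hN⟩ p')).2 ⟨i + 1, hiN⟩| ≤ (1 + lam) * R ^ 2 :=
    ⟨abs_snd_le_of_siteEnergy_le hω.le hl.le hβ ⟨i, hiN'⟩ (X ⟨i, hiN'⟩) (hX ⟨i, hiN'⟩) hP0 hEP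
        (hcap s hsI i hiN' (by omega)).2,
      abs_snd_le_of_siteEnergy_le hω.le hl.le hβ ⟨i + 1, hiN⟩ (X ⟨i + 1, hiN⟩) (hX ⟨i + 1, hiN⟩) hP0 hEP
        (hcap s hsI (i + 1) hiN (by omega)).2⟩
  -- the block light cone with `L = 2i+1`, `θ = 1/2`, `Λ = A₀ R`, `P = (1+lam) R²`, at `t = s`
  have hmain := kick_current_le_of_box hω hl.le hβ x (x.1, Function.update x.2 ⟨0, hN⟩ p')
    (fun n τ => if h : n < N then
      |(detFlow ω₂ lam β N τ x).1 ⟨n, h⟩ - (detFlow ω₂ lam β N τ (x.1, Function.update x.2 ⟨0, hN⟩ p')).1 ⟨n, h⟩|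
      else 0)
    (fun n τ => if h : n < N then
      |(detFlow ω₂ lam β N τ x).2 ⟨n, h⟩ - (detFlow ω₂ lam β N τ (x.1, Function.update x.2 ⟨0, hN⟩ p')).2 ⟨n, h⟩|
      else 0)
    (fun _ _ => rfl) (fun _ _ => rfl) hR0 hP0 hΛ1 hΛU hΛV (by norm_num : (0 : ℝ) < 1 / 2)
    (by norm_num : (1 / 2 : ℝ) ≤ 1) (by omega : i + 1 ≤ 2 * i + 1) hiN p' rfl hbox hsI hmom
  refine hmain.trans ?_
  have hd1 : Nat.dist (2 * i + 1) i = i + 1 := by unfold Nat.dist; omega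
  have hd2 : Nat.dist (2 * i + 1) (i + 1) = i := by unfold Nat.dist; omega
  have hps : (1 / 2 : ℝ) ^ (i + 1) = (1 / 2) ^ i * (1 / 2) := pow_succ _ _
  rw [hd1, hd2, hps, hΛsq]
  -- the Grönwall factor inside the window: `e^{8 A₀ R s} ≤ e^{i/4}`, then `(1/2)^i e^{i/4} ≤ (2/3)^i`
  have hexp : Real.exp (A₀ * R * (4 + 2 * (1 / 2 : ℝ)⁻¹) * s) ≤ Real.exp ((i : ℝ) / 4) := by
    refine Real.exp_le_exp.2 ?_
    have e : A₀ * R * (4 + 2 * (1 / 2 : ℝ)⁻¹) * s = 8 * (A₀ * R * s) := by ring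
    rw [e]
    linarith
  have hgeo : (1 / 2 : ℝ) ^ i * Real.exp (A₀ * R * (4 + 2 * (1 / 2 : ℝ)⁻¹) * s) ≤ (2 / 3) ^ i :=
    (mul_le_mul_of_nonneg_left hexp (by positivity)).trans (half_pow_mul_exp_le i)
  -- the prefactor: `R + 4βR³ + (1+lam)R²·A₀R ≤ (1 + 4β + (1+lam)A₀) R³` for `R ≥ 1`
  have hcoef : R + 4 * β * R ^ 3 + (1 + lam) * R ^ 2 * (A₀ * R) ≤ (1 + 4 * β + (1 + lam) * A₀) * R ^ 3 := by
    nlinarith [mul_nonneg hR0 (sub_nonneg.2 hR2)]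
  have hM0 : 0 ≤ 3 / 2 * (|x.2 ⟨0, hN⟩ - p'| + 2 * K * R ^ 3 * s) := by positivity
  calc (R + 4 * β * R ^ 3 + (1 + lam) * R ^ 2 * (A₀ * R)) *
        (((1 / 2 : ℝ) ^ i + (1 / 2) ^ i * (1 / 2)) * |x.2 ⟨0, hN⟩ - p'| +
          2 * R * (K * R ^ 2) * ((1 / 2 : ℝ) ^ i * (1 / 2) + (1 / 2) ^ i) * s) *
        Real.exp (A₀ * R * (4 + 2 * (1 / 2 : ℝ)⁻¹) * s) =
      (R + 4 * β * R ^ 3 + (1 + lam) * R ^ 2 * (A₀ * R)) * (3 / 2 * (|x.2 ⟨0, hN⟩ - p'| + 2 * K * R ^ 3 * s)) *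
        ((1 / 2 : ℝ) ^ i * Real.exp (A₀ * R * (4 + 2 * (1 / 2 : ℝ)⁻¹) * s)) := by ring
    _ ≤ (1 + 4 * β + (1 + lam) * A₀) * R ^ 3 * (3 / 2 * (|x.2 ⟨0, hN⟩ - p'| + 2 * K * R ^ 3 * s)) *
        (2 / 3 : ℝ) ^ i :=
      mul_le_mul (mul_le_mul_of_nonneg_right hcoef hM0) hgeo (by positivity) (by positivity)
    _ = 3 / 2 * (1 + 4 * β + (1 + lam) * A₀) * R ^ 3 * (|x.2 ⟨0, hN⟩ - p'| + 2 * K * R ^ 3 * s) *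
        (2 / 3) ^ i := by ring

end GoodKick

/-! ### Registered sub-goal of the line (closed form of `kick_current_le_of_siteEnergy_le`) -/

/-- **Sub-goal `stub_floorGoodKick`** (registered on the crux item for this helper file; closed `∀`-form of
`kick_current_le_of_siteEnergy_le`): the good event of the floor of `stub_kickCone` — capped site energies along both
closed flows on the block `n ≤ 2i+2` give geometric decay `(2/3)^i` of the kicked transported bond current inside the
window `32 √(1+ω₂+3lam+12β) R s ≤ i`. [folklore] -/
theorem stub_floorGoodKick : ∀ (ω₂ lam β : ℝ), 0 < ω₂ → 0 < lam → 0 ≤ β → ∀ (N : ℕ) (X : Fin N → PhaseSpace N → ℝ), (∀ m : Fin N, X m = (fun x => (∑ k' : Fin N, (if k' = m then (1 : ℝ) else 0) * (x.2 k' ^ 2 / 2 + (pinnedChain ω₂ lam β 0).U (x.1 k'))) + ∑ k' : Fin N, ∑ l : Fin N, if l.val = k'.val + 1 then ((if k' = m then (1 : ℝ) else 0) + (if l = m then (1 : ℝ) else 0)) / 2 * (pinnedChain ω₂ lam β 0).V (x.1 l - x.1 k') else 0)) → ∀ (i : ℕ) (hiN : i + 1 < N) (x : PhaseSpace N) (p'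 R s : ℝ), 1 ≤ R → 0 ≤ s → 32 * Real.sqrt (1 + ω₂ + 3 * lam + 12 * β) * R * s ≤ i → (∀ τ ∈ Set.Icc (0 : ℝ) s, ∀ (n : ℕ) (h : n < N), n ≤ 2 * i + 2 → X ⟨n, h⟩ (Summit.AtomisticToContinuum.FouriersLaw.Theorems.ClosedConeSensitivity.Negative.ZeroFrictionDictionary.detFlow ω₂ lam β N τ x) ≤ lam * R ^ 4 / 4 ∧ X ⟨n, h⟩ (Summit.AtomisticToContinuum.FouriersLaw.Theorems.ClosedConeSensitivity.Negative.ZeroFrictionDictionary.detFlow ω₂ lam β N τ (x.1, Function.update x.2 ⟨0, by omega⟩ p')) ≤ lam * R ^ 4 / 4) → |(pinnedChain ω₂ lam β 0).bondCurrent N ⟨i, by omega⟩ (Summit.AtomisticToContinuum.FouriersLaw.Theorems.ClosedConeSensitivity.Negative.ZeroFrictionDictionary.detFlow ω₂ lam β N s x) - (pinnedChain ω₂ lam β 0).bondCurrent N ⟨i, by omega⟩ (Summit.AtomisticToContinuum.FouriersLaw.Theorems.ClosedConeSensitivity.Negative.ZeroFrictionDictionary.detFlow ω₂ lam β N s (x.1,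 Function.update x.2 ⟨0, by omega⟩ p'))| ≤ 3 / 2 * (1 + 4 * β + (1 + lam) * Real.sqrt (1 + ω₂ + 3 * lam + 12 * β)) * R ^ 3 * (|x.2 ⟨0, by omega⟩ - p'| + 2 * (1 + ω₂ + 3 * lam + 12 * β) * R ^ 3 * s) * (2 / 3) ^ i :=
  fun _ _ _ hω hl hβ _ X hX _ hiN x p' _ _ hR hs hwin hcap =>
    kick_current_le_of_siteEnergy_le hω hl hβ X hX hiN x p' hR hs hwin hcap

end Summit.AtomisticToContinuum.FouriersLaw.Theorems.OddSectorIrreversibility.TapLeak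

end
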